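import Summits.CriticalPhenomena.PercolationContinuityZ3.Theorems.SoloBlindSlitLadder
import Literature.Probability.Percolation.FiniteEnergy
import Literature.Probability.Percolation.HalfSpaceStar
import HarnessLib

/-!
# Isolated pores pay twice: the period-`M ≥ 2` slit rungs under `p_c² · T_M < 1`

Seat `solo-CriticalPhenomena-blind`.  In the slit region `R_M = ℍ ∪ L_M`,
`L_M = {x₀ ≤ -2} ∪ {(-1,0,Mj)}`, with `M ≥ 2` the pores `(-1,0,Mj)` are ISOLATED: inside `L_M` a pore
has the single neighbour `(-2,0,Mj)`.  Hence a lower piece joining two pores uses the two forced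
vertical edges below them and a connection inside the deep half-space `{x₀ ≤ -2}` between the points
below (`openConnVia_KL0_pore_subset`; dead-end vertices can be avoided by paths,
`reachable_avoiding_deadEnds`).  The three events are determined by disjoint edge sets, so
`κ_L(z,z') ≤ p_c³ · τ_ℍ(z'-z)` (`kerL_false_le_deep`, reflection `{x₀ ≤ -2} ≅ ℍ`), against
`κ_ℍ ≤ p_c · τ_ℍ`; the contraction number is `≤ (p_c² T_M)²` and

* `mem_slitPeriods_of_deep`: `M ≥ 2 ∧ p_c² · T_M < 1 ⟹ M ∈ slitPeriods` (hence `M ∈ finPeriods`);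
* `mem_slitPeriods_of_TM_le_four`: with the tree's `p_c(ℤ³) < 1/2`, **`T_M ≤ 4` suffices** for
  `M ≥ 2` (the period-1 criterion of `SoloBlindSlitRate` needs `T₀ ≤ 2`; for `M = 1` the feet are
  adjacent and no such gain is available).

Numerically `T_2 = Σ_{j≠0} τ_ℍ(2j) ≈ 0.45`, a margin of `≈ 9` for the period-2 slit and fin rungs.
-/

noncomputable section

namespace Summit.CriticalPhenomena.PercolationContinuityZ3.Theorems

open MeasureTheory Filter Topology Literature.Probability.Percolation Literature.Probability.LatticeModels
open scoped ENNReal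

/-! ### A graph lemma: dead ends can be avoided -/

/-- If every vertex of `S` has at most one `H`-neighbour, then two vertices outside `S` joined in `H`
are joined in any graph `H'` containing the `H`-edges with both endpoints outside `S`
(a path never passes through a vertex of degree `≤ 1`). -/
theorem reachable_avoiding_deadEnds {V : Type*} {H H' : SimpleGraph V} {S : Set V}
    (hS : ∀ c ∈ S, ∀ a b, H.Adj c a → H.Adj c b → a = b)
    (hH' : ∀ a b, a ∉ S → b ∉ S → H.Adj a b → H'.Adj a b) {u v : V}
    (hu : u ∉ S) (hv : v ∉ S) (h : H.Reachable u v) : H'.Reachable u v := by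
  classical
  obtain ⟨p⟩ := h
  have key : ∀ {a b : V} (q : H.Walk a b), q.IsPath → a ∉ S → b ∉ S → H'.Reachable a b := by
    intro a b q
    induction q with
    | nil => intro _ _ _; exact SimpleGraph.Reachable.refl _
    | @cons a w b hadj q ih =>
      intro hp ha hb
      rw [SimpleGraph.Walk.cons_isPath_iff] at hp
      have hw : w ∉ S := by
        intro hwS
        cases q with
        | nil => exact hb hwS
        | @cons _ w' _ h2 r =>
          have haw' : a = w' := hS w hwS a w' hadj.symm h2
          apply hp.2
          rw [SimpleGraph.Walk.support_cons, haw']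
          exact List.mem_cons_of_mem _ r.start_mem_support
      exact (hH' a w ha hw hadj).reachable.trans (ih hp.1 hw hb)
  exact key p.bypass p.bypass_isPath hu hv

/-! ### Geometry: pores of `L_{Mℤ}`, `M ≥ 2`, are dead ends -/

/-- Two consecutive integers are not both multiples of `M ≥ 2`. -/
theorem ZM_succ_false {M : ℕ} (hM : 2 ≤ M) {x : ℤ} (h1 : x ∈ ZM M) (h2 : x + 1 ∈ ZM M) : False := by
  have h : (M : ℤ) ∣ 1 := by
    have := dvd_sub h2 h1
    rwa [add_sub_cancel_left] at this
  have hM1 : (M : ℤ) = 1 := Int.eq_one_of_dvd_one (by positivity) h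
  omega

/-- The point `(-2,0,z)` below the pore `(-1,0,z)`. -/
def lowerPt (z : ℤ) : Site 3 := cpt false z - Pi.single 0 1

/-- Coordinates of a foot. -/
theorem cpt_false_apply_zero (z : ℤ) : cpt false z 0 = -1 := by simp [cpt]

/-- Coordinates of a foot. -/
theorem cpt_false_apply_one (z : ℤ) : cpt false z 1 = 0 := by simp [cpt]

/-- Coordinates of the point below a foot. -/
theorem lowerPt_apply_zero (z : ℤ) : lowerPt z 0 = -2 := by simp [lowerPt, cpt]

/-- Coordinates of the point below a foot. -/
theorem lowerPt_apply_of_ne (z : ℤ) {i : Fin 3} (hi : i ≠ 0) : lowerPt z i = cpt false z i := by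
  simp [lowerPt, Pi.single_eq_of_ne hi]

/-- The foot sits on top of the point below it. -/
theorem cpt_false_eq_lowerPt_add (z : ℤ) : cpt false z = lowerPt z + Pi.single 0 1 := by
  simp [lowerPt]

/-- The vertical edge below a pore is an edge of `ℤ³`. -/
theorem cpt_false_adj_lowerPt (z : ℤ) : (zdGraph 3).Adj (cpt false z) (lowerPt z) :=
  (zdGraph_adj_iff _ _).2 ⟨0, Or.inr (cpt_false_eq_lowerPt_add z)⟩

/-- **Pores are dead ends.** For `M ≥ 2`, a vertex `c` of `L_{Mℤ}` with `c₀ = -1` (a pore) has the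
single neighbour `c - e₀` inside `L_{Mℤ}`. -/
theorem eq_sub_single_of_adj_slitZ {M : ℕ} (hM : 2 ≤ M) {c a : Site 3} (hc : c 0 = -1)
    (h : (withinGraph (zdGraph 3) (slitZ (ZM M))).Adj c a) : a = c - Pi.single 0 1 := by
  obtain ⟨hadj, hcL, haL⟩ := h
  have hc' : c 1 = 0 ∧ c 2 ∈ ZM M := by
    rcases hcL with h | ⟨-, h1, h2⟩
    · exact absurd h (by omega)
    · exact ⟨h1, h2⟩
  obtain ⟨hc1, hc2⟩ := hc'
  have haL' : a 0 ≤ -2 ∨ (a 0 = -1 ∧ a 1 = 0 ∧ a 2 ∈ ZM M) := haL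
  obtain ⟨i, hi | hi⟩ := (zdGraph_adj_iff c a).1 hadj
  · exfalso
    have e0 : a 0 = c 0 + (Pi.single i (1 : ℤ) : Site 3) 0 := by rw [hi]; rfl
    have e1 : a 1 = c 1 + (Pi.single i (1 : ℤ) : Site 3) 1 := by rw [hi]; rfl
    have e2 : a 2 = c 2 + (Pi.single i (1 : ℤ) : Site 3) 2 := by rw [hi]; rfl
    fin_cases i <;> simp at e0 e1 e2
    · rcases haL' with ha | ⟨ha, -⟩ <;> omega
    · rcases haL' with ha | ⟨-, ha, -⟩ <;> omega
    · rcases haL' with ha | ⟨-, -, ha2⟩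
      · omega
      · rw [e2] at ha2; exact ZM_succ_false hM hc2 ha2
  · have e0 : c 0 = a 0 + (Pi.single i (1 : ℤ) : Site 3) 0 := by rw [hi]; rfl
    have e1 : c 1 = a 1 + (Pi.single i (1 : ℤ) : Site 3) 1 := by rw [hi]; rfl
    have e2 : c 2 = a 2 + (Pi.single i (1 : ℤ) : Site 3) 2 := by rw [hi]; rfl
    fin_cases i <;> simp at e0 e1 e2
    · rw [hi]; simp
    · exfalso; rcases haL' with ha | ⟨-, ha, -⟩ <;> omega
    · exfalso
      rcases haL' with ha | ⟨-, -, ha2⟩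
      · omega
      · rw [e2] at hc2; exact ZM_succ_false hM ha2 hc2

/-! ### The lower piece between two pores: two forced edges and a deep connection -/

/-- The deep half-space `{x₀ ≤ -2}`. -/
def deepD : Set (Site 3) := {x : Site 3 | x 0 ≤ -2}

/-- **Lower pieces between distinct pores of `R_M`, `M ≥ 2`**, contain the two vertical edges below the
pores and a connection inside `{x₀ ≤ -2}` between the points below. -/
theorem openConnVia_KL0_pore_subset {M : ℕ} (hM : 2 ≤ M) {z z' : ℤ} (hz : z ∈ ZM M) (hne : z ≠ z') :
    openConnVia (KL0 (ZM M)) (cpt false z) (cpt false z') ⊆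
      ({ω | s(cpt false z, lowerPt z) ∈ ω} ∩ {ω | s(cpt false z', lowerPt z') ∈ ω}) ∩
        openConnVia (withinGraph (zdGraph 3) deepD) (lowerPt z) (lowerPt z') := by
  intro ω hω
  have hL : cpt false z' ∈ openClusterIn (withinGraph (zdGraph 3) (slitZ (ZM M))) ω (cpt false z) :=
    pieceL_subset_of_mem_slitZ (cpt_mem_sideL (Z := ZM M) false hz) hω
  rw [mem_openClusterIn_iff] at hL
  set H := openGraph ω ⊓ withinGraph (zdGraph 3) (slitZ (ZM M)) with hH
  have hcne : cpt false z ≠ cpt false z' := fun h => hne (cpt_injective false h)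
  -- neighbours of pores in `H`
  have hnb : ∀ {c a : Site 3}, c 0 = -1 → H.Adj c a → a = c - Pi.single 0 1 ∧ s(c, a) ∈ ω := by
    intro c a hc h
    rw [hH, SimpleGraph.inf_adj, openGraph_adj] at h
    exact ⟨eq_sub_single_of_adj_slitZ hM hc h.2, h.1.1⟩
  obtain ⟨p⟩ := hL
  have hp : ¬p.Nil := fun hn => hcne hn.eq
  have hfirst := hnb (cpt_false_apply_zero z) (p.adj_snd hp)
  have hp' : ¬p.reverse.Nil := fun hn => hcne hn.eq.symm
  have hlast := hnb (cpt_false_apply_zero z') (p.reverse.adj_snd hp')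
  refine ⟨⟨?_, ?_⟩, ?_⟩
  · show s(cpt false z, lowerPt z) ∈ ω
    rw [lowerPt, ← hfirst.1]; exact hfirst.2
  · show s(cpt false z', lowerPt z') ∈ ω
    rw [lowerPt, ← hlast.1]; exact hlast.2
  -- the deep connection between the points below
  show lowerPt z' ∈ openClusterIn (withinGraph (zdGraph 3) deepD) ω (lowerPt z)
  rw [mem_openClusterIn_iff]
  have hreach : H.Reachable (lowerPt z) (lowerPt z') := by
    have h1 : H.Reachable (cpt false z) (lowerPt z) := by
      have := (p.adj_snd hp).reachable; rwa [hfirst.1] at this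
    have h2 : H.Reachable (cpt false z') (lowerPt z') := by
      have := (p.reverse.adj_snd hp').reachable; rwa [hlast.1] at this
    exact h1.symm.trans (⟨p⟩ : H.Reachable _ _) |>.trans h2
  refine reachable_avoiding_deadEnds (H := H) (S := {x : Site 3 | x 0 = -1}) ?_ ?_
    (by simp [lowerPt_apply_zero]) (by simp [lowerPt_apply_zero]) hreach
  · intro c hc a b ha hb
    rw [(hnb hc ha).1, (hnb hc hb).1]
  · intro a b ha hb h
    rw [hH, SimpleGraph.inf_adj] at h
    obtain ⟨hopen, hadj, haL, hbL⟩ := h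
    refine (SimpleGraph.inf_adj _ _ _ _).2 ⟨hopen, hadj, ?_, ?_⟩
    · rcases haL with h | ⟨h, -⟩
      · exact h
      · exact absurd h ha
    · rcases hbL with h | ⟨h, -⟩
      · exact h
      · exact absurd h hb

/-! ### Probability of the three-event intersection -/

/-- The vertical edge below a pore is not an edge of the deep half-space graph. -/
theorem edge_below_not_mem_deep (z : ℤ) :
    s(cpt false z, lowerPt z) ∉ (withinGraph (zdGraph 3) deepD).edgeSet := by
  intro h
  rw [SimpleGraph.mem_edgeSet, withinGraph_adj] at h
  have : cpt false z 0 ≤ -2 := h.2.1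
  rw [cpt_false_apply_zero] at this
  omega

/-- `P(both vertical edges open and the points below are joined inside {x₀ ≤ -2}) = p_c² · P(joined)`. -/
theorem measure_edges_inter_deep {z z' : ℤ} (hne : z ≠ z') :
    Pc (({ω | s(cpt false z, lowerPt z) ∈ ω} ∩ {ω | s(cpt false z', lowerPt z') ∈ ω}) ∩
        openConnVia (withinGraph (zdGraph 3) deepD) (lowerPt z) (lowerPt z')) =
      pcE * pcE * Pc (openConnVia (withinGraph (zdGraph 3) deepD) (lowerPt z) (lowerPt z')) := by
  have hee : s(cpt false z, lowerPt z) ≠ s(cpt false z', lowerPt z') := by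
    intro h
    rcases Sym2.eq_iff.1 h with ⟨h1, -⟩ | ⟨h1, -⟩
    · exact hne (cpt_injective false h1)
    · have := congrArg (fun f : Site 3 => f 0) h1
      simp only [cpt_false_apply_zero, lowerPt_apply_zero] at this
      omega
  have hA := BGN.determinedBy_mem_edge (s(cpt false z, lowerPt z))
  have hB := BGN.determinedBy_mem_edge (s(cpt false z', lowerPt z'))
  have hAB : Pc ({ω | s(cpt false z, lowerPt z) ∈ ω} ∩ {ω | s(cpt false z', lowerPt z') ∈ ω}) =
      pcE * pcE := by
    unfold Pc
    rw [bondPercolation_inter_of_disjoint (zdGraph 3) (criticalProbI 3) (by simpa using hee) hA hB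
      (measurableSet_mem _) (measurableSet_mem _)]
    change Pc _ * Pc _ = _
    rw [Pc_edge (cpt_false_adj_lowerPt z), Pc_edge (cpt_false_adj_lowerPt z')]
  have hABdet : DeterminedBy ({ω | s(cpt false z, lowerPt z) ∈ ω} ∩ {ω | s(cpt false z', lowerPt z') ∈ ω})
      ({s(cpt false z, lowerPt z), s(cpt false z', lowerPt z')} : Set (Sym2 (Site 3))) :=
    (hA.mono (by simp)).inter (hB.mono (by simp))
  have hdisj : Disjoint ({s(cpt false z, lowerPt z), s(cpt false z', lowerPt z')} : Set (Sym2 (Site 3)))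
      (withinGraph (zdGraph 3) deepD).edgeSet := by
    rw [Set.disjoint_left]
    intro e he
    rcases he with rfl | rfl
    · exact edge_below_not_mem_deep z
    · exact edge_below_not_mem_deep z'
  unfold Pc at hAB ⊢
  rw [bondPercolation_inter_of_disjoint (zdGraph 3) (criticalProbI 3) hdisj hABdet
    (determinedBy_openConnVia _ _ _) ((measurableSet_mem _).inter (measurableSet_mem _))
    (measurableSet_openConnVia _ _ _), hAB]

/-! ### Reflection: the deep half-space is a copy of `ℍ` -/

/-- The reflection `u ↦ (-2 - u₀, u₁, u₂)`, carrying `{x₀ ≤ -2}` onto `ℍ`. -/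
def reflIso2 : zdGraph 3 ≃g zdGraph 3 :=
  (zdShiftIso (Pi.single 0 (-(-2 : ℤ)))).trans
    (zdSignedPermIso (Equiv.swap 0 0) (Function.update 1 0 (-1)))

/-- The `0`-th coordinate of the reflection. -/
theorem reflIso2_apply_zero (u : Site 3) : reflIso2.toEquiv u 0 = -2 - u 0 :=
  RegionGluing.shift_swap_neg_apply_zero 0 (-2) u

/-- The reflection fixes the other coordinates. -/
theorem reflIso2_apply_of_ne (u : Site 3) {i : Fin 3} (hi : i ≠ 0) : reflIso2.toEquiv u i = u i := by
  simp [reflIso2, RelIso.trans_apply, Equiv.swap_self, Function.update_of_ne hi, Pi.single_eq_of_ne hi]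

/-- The reflection maps the point below a pore to the connector: `(-2,0,z) ↦ (0,0,z)`. -/
theorem reflIso2_lowerPt (z : ℤ) : reflIso2.toEquiv (lowerPt z) = cpt true z := by
  funext i
  by_cases hi : i = 0
  · subst hi; rw [reflIso2_apply_zero, lowerPt_apply_zero]; simp [cpt]
  · rw [reflIso2_apply_of_ne _ hi, lowerPt_apply_of_ne _ hi]
    have h1 := reflIso_apply_of_ne (cpt false z) hi
    rw [reflIso_cpt_false] at h1
    exact h1.symm

/-- Reflection invariance: the deep two-point function between the points below the pores is
`τ_ℍ(z' - z)`. -/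
theorem measure_openConnVia_deep_eq (z z' : ℤ) :
    Pc (openConnVia (withinGraph (zdGraph 3) deepD) (lowerPt z) (lowerPt z')) = tauH (z' - z) := by
  have hH : ∀ u, reflIso2.toEquiv u ∈ hsp ↔ u ∈ deepD := fun u => by
    simp only [hsp, deepD, Set.mem_setOf_eq, reflIso2_apply_zero]; omega
  have hK : ∀ u v, (withinGraph (zdGraph 3) hsp).Adj (reflIso2.toEquiv u) (reflIso2.toEquiv v) ↔
      (withinGraph (zdGraph 3) deepD).Adj u v := by
    intro u v
    simp only [withinGraph_adj, hH, reflIso2.map_rel_iff']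
  have hpre := relabel_preimage_openConnVia reflIso2.toEquiv hK (lowerPt z) (lowerPt z')
  have hreal := bondPercolation_real_preimage_relabel_iso reflIso2 (criticalProbI 3)
    (openConnVia (withinGraph (zdGraph 3) hsp) (reflIso2.toEquiv (lowerPt z))
      (reflIso2.toEquiv (lowerPt z')))
  rw [hpre] at hreal
  rw [measureReal_def, measureReal_def,
    ENNReal.toReal_eq_toReal_iff' (measure_ne_top _ _) (measure_ne_top _ _)] at hreal
  rw [reflIso2_lowerPt, reflIso2_lowerPt] at hreal
  change Pc _ = Pc _ at hreal
  rw [hreal]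
  have := measure_openConnVia_hsp_shift z (z' - z)
  rwa [sub_add_cancel] at this

/-! ### The improved lower kernel and the criterion -/

/-- **Isolated pores pay twice**: for `M ≥ 2`, `κ_L(z,z') ≤ 1[adm] · τ_ℍ(z'-z) · p_c³`. -/
theorem kerL_false_le_deep {M : ℕ} (hM : 2 ≤ M) (z z' : ℤ) :
    kerL (ZM M) false z z' ≤ admInd (ZM M) z z' * (tauH (z' - z) * (pcE * pcE * pcE)) := by
  by_cases h : z ∈ ZM M ∧ z' ∈ ZM M ∧ z' ≠ z
  · obtain ⟨hz, -, hne⟩ := h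
    unfold kerL
    have hedge : Pc {ω | s(cpt false z', cpt (!false) z') ∈ ω} = pcE := by
      have := Pc_edge (cpt_adj z')
      rwa [Sym2.eq_swap] at this
    rw [hedge]
    refine mul_le_mul' le_rfl ?_
    calc Pc (openConnVia (KL0 (ZM M)) (cpt false z) (cpt false z')) * pcE
        ≤ Pc (({ω | s(cpt false z, lowerPt z) ∈ ω} ∩ {ω | s(cpt false z', lowerPt z') ∈ ω}) ∩
            openConnVia (withinGraph (zdGraph 3) deepD) (lowerPt z) (lowerPt z')) * pcE :=
          mul_le_mul' (measure_mono (openConnVia_KL0_pore_subset hM hz (Ne.symm hne))) le_rfl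
      _ = tauH (z' - z) * (pcE * pcE * pcE) := by
          rw [measure_edges_inter_deep (Ne.symm hne), measure_openConnVia_deep_eq]; ring
  · rw [kerL, admInd_eq_zero h, zero_mul, zero_mul]

/-- The lower kernel norm of `R_M`, `M ≥ 2`, is at most `T_M · p_c³`. -/
theorem kerTot_kerL_false_le_deep {M : ℕ} (hM : 2 ≤ M) :
    kerTot (kerL (ZM M)) false ≤ TM M * (pcE * pcE * pcE) :=
  kerTot_le_of_le_admInd_ZM M (by omega) (kerL (ZM M)) tauH (pcE * pcE * pcE) false
    fun z z' => kerL_false_le_deep hM z z'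

/-- **Deep slit criterion.** For `M ≥ 2`: `p_c(ℤ³)² · T_M < 1 ⟹ M ∈ slitPeriods`. -/
theorem mem_slitPeriods_of_deep {M : ℕ} (hM : 2 ≤ M) (h : pcE * pcE * TM M < 1) :
    M ∈ slitPeriods := by
  intro h0
  have hM1 : 1 ≤ M := by omega
  have hT : TM M ≠ ⊤ := by
    intro hT
    rw [hT, ENNReal.mul_top (ENNReal.mul_pos pcE_pos.ne' pcE_pos.ne').ne'] at h
    exact not_top_lt h
  have hΓ : ∑' z, startL (ZM M) (0 : Site 3) true z ≠ ⊤ :=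
    ne_top_of_le_ne_top (by simpa using hT) (tsum_startL_ZM_le M hM1)
  have h' : TM M * pcE * pcE < 1 := by
    calc TM M * pcE * pcE = pcE * pcE * TM M := by ring
      _ < 1 := h
  have hρ : kerTot (kerL (ZM M)) true * kerTot (kerL (ZM M)) false < 1 := by
    calc kerTot (kerL (ZM M)) true * kerTot (kerL (ZM M)) false
        ≤ TM M * pcE * (TM M * (pcE * pcE * pcE)) :=
          mul_le_mul' (kerTot_kerL_ZM_le M hM1 true) (kerTot_kerL_false_le_deep hM)
      _ = (TM M * pcE * pcE) * (TM M * pcE * pcE) := by ring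
      _ ≤ (TM M * pcE * pcE) * 1 := mul_le_mul' le_rfl h'.le
      _ = TM M * pcE * pcE := mul_one _
      _ < 1 := h'
  have hzero := measure_percolatesVia_KL_eq_zero (Z := ZM M) (0 : Site 3) true zero_mem_hsp hΓ hρ
  rw [theta_induce_eq_real_percolatesVia, measureReal_def]
  change (Pc (percolatesVia (KL (ZM M)) 0)).toReal = 0
  rw [hzero, ENNReal.toReal_zero]

/-- **`T_M ≤ 4` suffices for `M ≥ 2`** (with the tree's `p_c(ℤ³) < 1/2`). -/
theorem mem_slitPeriods_of_TM_le_four {M : ℕ} (hM : 2 ≤ M) (h : TM M ≤ 4) : M ∈ slitPeriods := by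
  refine mem_slitPeriods_of_deep hM ?_
  have h2 : pcE * pcE < 2⁻¹ * 2⁻¹ := ENNReal.mul_lt_mul pcE_lt_half pcE_lt_half
  have h4 : (2⁻¹ * 2⁻¹ : ℝ≥0∞) = 1 / 4 := by
    rw [← ENNReal.mul_inv (Or.inl (by norm_num)) (Or.inl (by norm_num)), one_div]; norm_num
  rw [h4] at h2
  calc pcE * pcE * TM M ≤ pcE * pcE * 4 := mul_le_mul' le_rfl h
    _ < 1 := ENNReal.mul_lt_of_lt_div h2

/-- The period-`M` fin rung follows as well (`R_M ⊇ S_M`). -/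
theorem mem_finPeriods_of_TM_le_four {M : ℕ} (hM : 2 ≤ M) (h : TM M ≤ 4) : M ∈ finPeriods :=
  slitPeriods_subset_finPeriods (mem_slitPeriods_of_TM_le_four hM h)

end Summit.CriticalPhenomena.PercolationContinuityZ3.Theorems

end
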